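import Mathlib
import Summits.Ventures.PercRepro2.Defs
import Summits.Ventures.PercRepro2.Graph
import Summits.Ventures.PercRepro2.Induced
import Summits.Ventures.PercRepro2.BHKAvoid
import Summits.Ventures.PercRepro2.YBridge
import Summits.Ventures.PercRepro2.Inst8Kernel

/-!
# Instance graphs on eight vertices in the tree's vocabulary, and the bitmask closure is `Conn`
(blind cell PercRepro2, typer-1 g14; the bridge file of `Inst8Kernel.lean`, after `K5Conn.lean`)

`ends G : Fin 10 → Sym2 (Fin 8)` is the instance graph `G : Inst` with the marks `o = 0, a₁ = 1, a₂ = 2,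
a₃ = 3` (and `b`) among its vertices.  `conn_iff`: the seven-fold bitmask closure `Inst8.conn G ω u v`
of `Inst8Kernel.lean` is exactly the tree's connection relation `Conn (ends G) ω u v` — a closure step
adds the open neighbours of the reached vertices (`testBit_step`, `testBit_nb`), so a reached vertex is
reachable (`reachable_of_mem`) and every vertex at walk distance `≤ 7` is reached (`mem_of_walk`); a
path on eight vertices has length `≤ 7`.  Hence the tables `tQ`, `tPD`, `tPDoU`, `tL`, `tH` are the
indicators of the tree's events (`tQ_iff`, …, `tH_iff`).
-/

namespace Summit.Ventures.PercRepro2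

namespace Inst8

/-! ## Instance graphs as graphs of the tree -/

/-- The instance graph in the tree's vocabulary. -/
def ends (G : Inst) : Fin 10 → Sym2 (Fin 8) := fun e => s(⟨G.ea e, G.ea_lt e⟩, ⟨G.eb e, G.eb_lt e⟩)

/-- `ends G e = s(x, y)` iff `{ea e, eb e} = {x, y}`. -/
lemma ends_eq_iff (G : Inst) (e : Fin 10) (x y : Fin 8) :
    ends G e = s(x, y) ↔ (G.ea e = x ∧ G.eb e = y) ∨ (G.eb e = x ∧ G.ea e = y) := by
  unfold ends
  rw [Sym2.eq_iff]
  constructor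
  · rintro (⟨h1, h2⟩ | ⟨h1, h2⟩)
    · exact Or.inl ⟨by rw [← h1], by rw [← h2]⟩
    · exact Or.inr ⟨by rw [← h2], by rw [← h1]⟩
  · rintro (⟨h1, h2⟩ | ⟨h1, h2⟩)
    · exact Or.inl ⟨Fin.ext h1, Fin.ext h2⟩
    · exact Or.inr ⟨Fin.ext h2, Fin.ext h1⟩

/-! ## Bits of the closure -/

/-- A fold of `lor`s: bit `v` of `l.foldl (· ||| h ·) acc` is bit `v` of `acc` or of some `h x`. -/
lemma testBit_foldl_lor {α : Type*} (h : α → ℕ) (v : ℕ) :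
    ∀ (l : List α) (acc : ℕ),
      (l.foldl (fun acc x => acc ||| h x) acc).testBit v =
        (acc.testBit v || l.any fun x => (h x).testBit v)
  | [], acc => by simp
  | x :: l, acc => by
    rw [List.foldl_cons, testBit_foldl_lor h v l, Nat.testBit_lor, List.any_cons]
    simp only [Bool.or_assoc]

/-- The neighbour contribution of one edge. -/
def nbEdge (G : Inst) (ω : Fin 10 → Bool) (u : ℕ) (e : Fin 10) : ℕ :=
  if ω e then (if G.ea e = u then 1 <<< G.eb e else if G.eb e = u then 1 <<< G.ea e else 0) else 0

/-- `nb` is a fold of `lor`s of the edge contributions. -/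
lemma nb_eq_foldl (G : Inst) (ω : Fin 10 → Bool) (u : ℕ) :
    nb G ω u = (List.finRange 10).foldl (fun acc e => acc ||| nbEdge G ω u e) 0 := by
  unfold nb
  congr 1
  funext acc e
  unfold nbEdge
  split_ifs <;> simp

/-- Bit `v` of `1 <<< k` is `v = k`. -/
lemma testBit_one_shiftLeft (k v : ℕ) : (1 <<< k).testBit v = decide (k = v) := by
  rw [Nat.one_shiftLeft, Nat.testBit_two_pow]

/-- **Bit `v` of the neighbour mask of `u`**: some open edge joins `u` and `v`. -/
lemma testBit_nb (G : Inst) (ω : Fin 10 → Bool) (u v : ℕ) :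
    (nb G ω u).testBit v = true ↔
      ∃ e, ω e = true ∧ ((G.ea e = u ∧ G.eb e = v) ∨ (G.eb e = u ∧ G.ea e = v)) := by
  rw [nb_eq_foldl, testBit_foldl_lor, Nat.zero_testBit, Bool.false_or, List.any_eq_true]
  constructor
  · rintro ⟨e, -, he⟩
    unfold nbEdge at he
    refine ⟨e, ?_⟩
    by_cases hω : ω e = true
    · rw [if_pos hω] at he
      refine ⟨hω, ?_⟩
      by_cases h1 : G.ea e = u
      · rw [if_pos h1, testBit_one_shiftLeft, decide_eq_true_iff] at he
        exact Or.inl ⟨h1, he⟩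
      · rw [if_neg h1] at he
        by_cases h2 : G.eb e = u
        · rw [if_pos h2, testBit_one_shiftLeft, decide_eq_true_iff] at he
          exact Or.inr ⟨h2, he⟩
        · rw [if_neg h2, Nat.zero_testBit] at he
          exact absurd he Bool.false_ne_true
    · rw [if_neg hω, Nat.zero_testBit] at he
      exact absurd he Bool.false_ne_true
  · rintro ⟨e, hω, h⟩
    refine ⟨e, List.mem_finRange e, ?_⟩
    unfold nbEdge
    rw [if_pos hω]
    rcases h with ⟨h1, h2⟩ | ⟨h1, h2⟩
    · rw [if_pos h1, testBit_one_shiftLeft, decide_eq_true_iff]; exact h2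
    · have h3 : G.ea e ≠ u := fun h3 => G.ea_ne_eb e (h3.trans h1.symm)
      rw [if_neg h3, if_pos h1, testBit_one_shiftLeft, decide_eq_true_iff]; exact h2

/-- The contribution of one vertex to a closure step. -/
def stepV (G : Inst) (ω : Fin 10 → Bool) (R : ℕ) (u : ℕ) : ℕ := if R.testBit u then nb G ω u else 0

/-- `step` is a fold of `lor`s. -/
lemma step_eq_foldl (G : Inst) (ω : Fin 10 → Bool) (R : ℕ) :
    step G ω R = (List.range 8).foldl (fun acc u => acc ||| stepV G ω R u) R := by
  unfold step
  congr 1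
  funext acc u
  unfold stepV
  split_ifs <;> simp

/-- **Bit `v` of a closure step**: `v` was reached, or some reached `u < 8` has `v` as an open
neighbour. -/
lemma testBit_step (G : Inst) (ω : Fin 10 → Bool) (R : ℕ) (v : ℕ) :
    (step G ω R).testBit v = true ↔
      R.testBit v = true ∨ ∃ u, u < 8 ∧ R.testBit u = true ∧ (nb G ω u).testBit v = true := by
  rw [step_eq_foldl, testBit_foldl_lor, Bool.or_eq_true, List.any_eq_true]
  constructor
  · rintro (h | ⟨u, hu, h⟩)
    · exact Or.inl h
    · unfold stepV at h
      by_cases hR : R.testBit u = true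
      · rw [if_pos hR] at h
        exact Or.inr ⟨u, List.mem_range.1 hu, hR, h⟩
      · rw [if_neg hR, Nat.zero_testBit] at h
        exact absurd h Bool.false_ne_true
  · rintro (h | ⟨u, hu, hR, h⟩)
    · exact Or.inl h
    · refine Or.inr ⟨u, List.mem_range.2 hu, ?_⟩
      unfold stepV
      rw [if_pos hR]
      exact h

/-- Bits are preserved by a closure step. -/
lemma testBit_step_of_testBit (G : Inst) (ω : Fin 10 → Bool) (R : ℕ) {v : ℕ}
    (h : R.testBit v = true) : (step G ω R).testBit v = true :=
  (testBit_step G ω R v).2 (Or.inl h)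

/-! ## The closure is reachability -/

/-- `reach` is the seven-fold closure. -/
lemma reach_eq (G : Inst) (ω : Fin 10 → Bool) (u : ℕ) : reach G ω u = reachN G ω u 7 := rfl

/-- The closures are increasing. -/
lemma testBit_reachN_succ (G : Inst) (ω : Fin 10 → Bool) (u : ℕ) {n v : ℕ}
    (h : (reachN G ω u n).testBit v = true) : (reachN G ω u (n + 1)).testBit v = true :=
  testBit_step_of_testBit G ω _ h

/-- The closures are increasing (general form). -/
lemma testBit_reachN_of_le (G : Inst) (ω : Fin 10 → Bool) (u : ℕ) {n m v : ℕ} (hnm : n ≤ m)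
    (h : (reachN G ω u n).testBit v = true) : (reachN G ω u m).testBit v = true := by
  induction hnm with
  | refl => exact h
  | step _ ih => exact testBit_reachN_succ G ω u ih

/-- An open neighbour of a reached vertex is reached one step later. -/
lemma testBit_reachN_succ_of_adj (G : Inst) (ω : Fin 10 → Bool) (u : ℕ) {n : ℕ} {x y : Fin 8}
    (hx : (reachN G ω u n).testBit x = true) (hxy : OpenAdj (ends G) ω x y) :
    (reachN G ω u (n + 1)).testBit y = true := by
  refine (testBit_step G ω _ y).2 (Or.inr ⟨x, x.isLt, hx, ?_⟩)
  rw [testBit_nb]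
  obtain ⟨e, he, hends⟩ := hxy
  exact ⟨e, he, (ends_eq_iff G e x y).1 hends⟩

/-- Soundness: a reached vertex is connected to the root. -/
lemma reachable_of_mem (G : Inst) (ω : Fin 10 → Bool) (u v : Fin 8) :
    ∀ {n : ℕ}, (reachN G ω u n).testBit v = true → Conn (ends G) ω u v
  | 0, h => by
    rw [reachN, testBit_one_shiftLeft, decide_eq_true_iff] at h
    rw [Fin.ext h]
    exact conn_refl (ends G) ω v
  | n + 1, h => by
    rw [reachN, testBit_step] at h
    rcases h with h | ⟨x, hx8, hx, hxv⟩
    · exact reachable_of_mem G ω u v h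
    · rw [testBit_nb] at hxv
      obtain ⟨e, he, hev⟩ := hxv
      have hadj : OpenAdj (ends G) ω ⟨x, hx8⟩ v :=
        ⟨e, he, (ends_eq_iff G e ⟨x, hx8⟩ v).2 hev⟩
      have hne : (⟨x, hx8⟩ : Fin 8) ≠ v := by
        rintro rfl
        rcases hev with ⟨h1, h2⟩ | ⟨h1, h2⟩
        · exact G.ea_ne_eb e (h1.trans h2.symm)
        · exact G.ea_ne_eb e (h2.trans h1.symm)
      exact (reachable_of_mem G ω u ⟨x, hx8⟩ hx).trans
        ((openGraph_adj.2 ⟨hne, hadj⟩).reachable)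

/-- Completeness along a walk: a walk of length `l` from a reached vertex ends in a vertex reached
`l` steps later. -/
lemma mem_of_walk (G : Inst) (ω : Fin 10 → Bool) (u : ℕ) {x v : Fin 8}
    (p : (openGraph (ends G) ω).Walk x v) :
    ∀ {n : ℕ}, (reachN G ω u n).testBit x = true →
      (reachN G ω u (n + p.length)).testBit v = true := by
  induction p with
  | nil => intro n hx; simpa using hx
  | cons hadj _ ih =>
    intro n hx
    have := ih (testBit_reachN_succ_of_adj G ω u hx (openGraph_adj.1 hadj).2)
    rw [SimpleGraph.Walk.length_cons, ← Nat.add_assoc]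
    rwa [Nat.add_right_comm] at this

/-- **The bitmask closure is connectivity**: `conn G ω u v = true ↔ Conn (ends G) ω u v`. -/
theorem conn_iff (G : Inst) (ω : Fin 10 → Bool) (u v : Fin 8) :
    conn G ω u v = true ↔ Conn (ends G) ω u v := by
  unfold conn
  rw [reach_eq]
  refine ⟨reachable_of_mem G ω u v, fun h => ?_⟩
  refine h.elim_path fun p => ?_
  have hlen : p.1.length ≤ 7 := by
    have := p.2.length_lt
    rw [Fintype.card_fin] at this
    omega
  have hmem : (reachN G ω u (0 + p.1.length)).testBit v = true :=
    mem_of_walk G ω u p.1 (by rw [reachN, testBit_one_shiftLeft]; simp)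
  exact testBit_reachN_of_le G ω u (by omega) hmem

/-- `conn` on numbers below `8`, for the tables. -/
lemma conn_iff' (G : Inst) (ω : Fin 10 → Bool) {u v : ℕ} (hu : u < 8) (hv : v < 8) :
    conn G ω u v = true ↔ Conn (ends G) ω ⟨u, hu⟩ ⟨v, hv⟩ :=
  conn_iff G ω ⟨u, hu⟩ ⟨v, hv⟩

/-! ## The event tables are the tree's events -/

/-- The connection `u ↔ v` for numerals, as a set membership. -/
lemma conn_iff_mem (G : Inst) (ω : Fin 10 → Bool) {u v : ℕ} (hu : u < 8) (hv : v < 8) :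
    conn G ω u v = true ↔ ω ∈ connEvent (ends G) ⟨u, hu⟩ ⟨v, hv⟩ :=
  conn_iff' G ω hu hv

/-- `tQ ω ↔ ω ∈ Q = {a₁ ↮ a₂}`. -/
lemma tQ_iff (G : Inst) (ω : Fin 10 → Bool) : tQ G ω = true ↔ ω ∈ avoidAll (ends G) 2 {1} := by
  unfold tQ
  rw [Bool.not_eq_true', Bool.eq_false_iff, Ne, conn_iff' G ω (by norm_num) (by norm_num)]
  simp only [mem_avoidAll, Finset.mem_singleton, forall_eq]
  exact ⟨fun h hc => h (conn_symm hc), fun h hc => h (conn_symm hc)⟩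

/-- `tPD ω ↔ ω ∈ PD = Q ∩ {a₃ ∉ C₁ ∪ C₂}`. -/
lemma tPD_iff (G : Inst) (ω : Fin 10 → Bool) : tPD G ω = true ↔ ω ∈ PDEvent (ends G) 1 2 3 := by
  unfold tPD PDEvent Dtilde UnionCluster.inU
  rw [Bool.and_eq_true, Bool.and_eq_true, tQ_iff, Bool.not_eq_true', Bool.not_eq_true',
    Bool.eq_false_iff, Bool.eq_false_iff, Ne, Ne, conn_iff' G ω (by norm_num) (by norm_num),
    conn_iff' G ω (by norm_num) (by norm_num)]
  simp only [mem_avoidAll, Finset.mem_singleton, forall_eq, Set.mem_inter_iff, Set.mem_compl_iff,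
    Set.mem_union, mem_connEvent]
  constructor
  · rintro ⟨⟨hQ, h13⟩, h23⟩
    exact ⟨fun h => hQ (conn_symm h), fun h => h.elim (fun h => h13 (conn_symm h))
      (fun h => h23 (conn_symm h))⟩
  · rintro ⟨hQ, h⟩
    exact ⟨⟨fun h' => hQ (conn_symm h'), fun h' => h (Or.inl (conn_symm h'))⟩,
      fun h' => h (Or.inr (conn_symm h'))⟩

/-- `tPDoU ω ↔ ω ∈ PD ∩ {o ∈ C₁ ∪ C₂}`. -/
lemma tPDoU_iff (G : Inst) (ω : Fin 10 → Bool) :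
    tPDoU G ω = true ↔
      ω ∈ PDEvent (ends G) 1 2 3 ∩ (connEvent (ends G) 1 0 ∪ connEvent (ends G) 2 0) := by
  unfold tPDoU
  rw [Bool.and_eq_true, tPD_iff, Bool.or_eq_true, conn_iff_mem G ω (by norm_num) (by norm_num),
    conn_iff_mem G ω (by norm_num) (by norm_num)]
  exact Iff.rfl

/-- `L_v` is the event `{v ∈ C₁}`. -/
lemma tL_iff (G : Inst) (v : Fin 8) (ω : Fin 10 → Bool) :
    tL G v ω = true ↔ ω ∈ connEvent (ends G) 1 v :=
  conn_iff_mem G ω (by norm_num) v.isLt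

/-- `H_v` is the event `{v ∈ C₂}`. -/
lemma tH_iff (G : Inst) (v : Fin 8) (ω : Fin 10 → Bool) :
    tH G v ω = true ↔ ω ∈ connEvent (ends G) 2 v :=
  conn_iff_mem G ω (by norm_num) v.isLt

/-- **On `Q` no vertex lies in both clusters**: `v ∈ C₁` and `v ∈ C₂` force `a₁ ↔ a₂`. -/
lemma conn12_of (G : Inst) (ω : Fin 10 → Bool) (v : Fin 8) (hL : conn G ω 1 v = true)
    (hH : conn G ω 2 v = true) : conn G ω 1 2 = true := by
  have h1 : Conn (ends G) ω 1 v := (conn_iff G ω 1 v).1 hL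
  have h2 : Conn (ends G) ω 2 v := (conn_iff G ω 2 v).1 hH
  exact (conn_iff G ω 1 2).2 (conn_trans h1 (conn_symm h2))

end Inst8

end Summit.Ventures.PercRepro2
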